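import Summits.HodgeConjecture.CorCM.PointwiseConjugationCMFieldsHodge
import Summits.HodgeConjecture.CorCM.ForeignQuadraticCMFieldsHodge
import HarnessLib

/-!
# The fourth menu: CM elliptic curves with foreign fields and big slots under POINTWISE partial conjugations — the
# exact criterion for `∏_j E_j^{a_j} × ∏_b A_b^{c_b}` and the Hodge conjecture

COR-CM (cell `pub-hodgecm2`, binder seat `b16` gen 48, count-neutral claim PTCONJ, file F7; theorems only, no
definition, no named fact, no `sorry`).  NEW as stated, hence under `Summits/`.  HONEST FRAMING: the Hodge conjecture
for NAMED classes of CM abelian varieties; `HC_CM` is neither used nor asserted.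

`ForeignQuadraticCMFieldsHodge` (this seat, gen 37) runs the pairwise criterion for a family whose slots off
`B = {i | p i}` are imaginary quadratic (CM elliptic curves), pairwise distinguished, each FOREIGN to every `K_b`
(`IsEmpty (K_a →+* K_b)`), and whose big slots carry pairwise PARTIAL CONJUGATIONS (`σ` conjugation on all of
`Hom(K_b, ℂ)`, identity on all of `Hom(K_{b'}, ℂ)`) — the third menu.  With the exact criterion of
`PointwiseConjugationCMFieldsHodge` the big–big clause relaxes to its sharp form:

> (PC) for `b ≠ b'` in `B`: every pair `x : K_b → ℂ`, `y : K_{b'} → ℂ` admits `σ ∈ Aut(ℂ)` with `σ ∘ x = x̄`,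
> `σ ∘ y = y` — equivalently `y(K_{b'}) ⊄ x(K_b) · y(K_{b'}⁺)`, or `[x(K_b) y(K_{b'}) : ℚ] = 2 [x(K_b) y(K_{b'}⁺) : ℚ]`
> (`PointwiseConjugationCompositum[Degree]`).

* **`pairwise_of_menu₄`** — the pairwise criterion from: quadratic slots pairwise distinguished, foreign to the big
  fields, and (PC) inside `B`; `isNondegenerateFamily_iff_of_menu₄` (nondegenerate iff every big member is),
  `cmFamilyRank_add_card_eq_of_menu₄` (`Hg = ∏ Hg`); the third menu is contained (`pointwiseConj_of_menu₃_clause`).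
* **`isNondegenerateFamily_iff_forall_isEmpty_of_pointwiseConj`** — THE EXACT CRITERION under (PC) inside `B`:
  nondegenerate iff the big types are nondegenerate AND no curve field embeds in a `K_b` (⟹ by b23's
  shared-imaginary-quadratic degeneracy).
* §2 geometry: **`hodgeConjectureFor_prod_of_menu₄`**, `hodgeClassSpan_prod_eq_divisorClassesSpan_of_menu₄`,
  **`forall_prod_hodgeClassSpan_eq_iff_forall_isEmpty_of_pointwiseConj`** — for pairwise non-isogenous CM elliptic
  curves `E_j` with fields foreign to the `K_b` and realisations `A_b` of nondegenerate types whose fields satisfy (PC)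
  pairwise: the Hodge conjecture and `B• = D•` on EVERY `∏_j E_j^{a_j} × ∏_b A_b^{c_b}`, UNCONDITIONALLY; e.g. curves
  times a generic sextic threefold times its TWIN octic fourfold (same Galois closure, no partial conjugation, (PC) holds).

## References

* [MoonenZarhin1999LowDim] B. Moonen, Yu. Zarhin, *Hodge classes on abelian varieties of low dimension*, Math. Ann.
  315 (1999), Thm. (0.2) (a)/(4), Cor. (3.9).
* [Gordon1999HodgeAVSurvey] B. B. Gordon, *A survey of the Hodge conjecture for abelian varieties*, §3 Theorem (Imai,
  Murty) with proof; 7.5–7.7; 10.10.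
* [Serre1977] J.-P. Serre, *Linear Representations of Finite Groups*, GTM 42, §7.3–7.4.
-/

noncomputable section

open CategoryTheory CategoryTheory.Limits NumberField NumberField.ComplexEmbedding IntermediateField
open scoped BigOperators

namespace Summit.HodgeConjecture.CorCM

open Literature.NumberTheory.ComplexMultiplication
open Literature.AlgebraicGeometry.Motives (AbelianVariety CMType)
open Literature.AlgebraicGeometry.HodgeTheory
open Literature.AlgebraicGeometry.ComplexMultiplication (IsCMTypeRealisation)
open Literature.AlgebraicGeometry.VanGeemen1994 (hodgeClassSpan)
open Literature.AlgebraicGeometry.Pohlmann1968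
open Literature.Barriers.HodgeConjecture (divisorClassesSpan)

/-! ## §1 The fourth menu and the exact criterion -/

section Fields

variable {I : Type} {K : I → Type} [∀ i, Field (K i)] [∀ i, NumberField (K i)] [∀ i, IsCMField (K i)]

omit [∀ i, NumberField (K i)] [∀ i, IsCMField (K i)] in
/-- **The third menu's big–big clause implies (PC)**: a partial conjugation (`σ` conjugation on `Hom(K_a, ℂ)`, identity
on `Hom(K_b, ℂ)`) serves every pair `(x, y)`. [cite: Gordon1999HodgeAVSurvey, §3 Theorem (proof)] -/
theorem pointwiseConj_of_menu₃_clause {a b : I}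
    (h : ∃ σ : ℂ ≃+* ℂ, (∀ s : K a →+* ℂ, σ • s = conjugate s) ∧ ∀ s : K b →+* ℂ, σ • s = s) :
    ∀ (x : K a →+* ℂ) (y : K b →+* ℂ), ∃ σ : ℂ ≃+* ℂ, σ • x = (starRingAut : ℂ ≃+* ℂ) • x ∧ σ • y = y := by
  obtain ⟨σ, hσa, hσb⟩ := h
  exact fun x y => ⟨σ, by rw [hσa x, conj_smul_eq_conjugate], hσb y⟩

/-- **The fourth menu.**  The pairwise criterion holds for a family whose slots off `B = {i | p i}` are imaginary
quadratic and pairwise distinguished by some automorphism of `ℂ`, every quadratic slot being FOREIGN to every `K_b`,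
`b ∈ B`, and whose pairs inside `B` satisfy (PC): every pair of embeddings `x : K_b → ℂ`, `y : K_{b'} → ℂ` admits
`σ ∈ Aut(ℂ)` with `σ ∘ x = x̄`, `σ ∘ y = y`.  Contains the third menu (`pointwiseConj_of_menu₃_clause`).
[cite: MoonenZarhin1999LowDim, Thm. (0.2) (4)] [cite: Gordon1999HodgeAVSurvey, §3 Theorem (proof)] [cite: Serre1977, §7.3–7.4] -/
theorem pairwise_of_menu₄ (p : I → Prop) (Φ : ∀ i, CMType (K i))
    (h2 : ∀ j, ¬p j → Module.finrank ℚ (K j) = 2)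
    (hχ : ∀ i j, ¬p i → ¬p j → i ≠ j → ∃ g : ℂ ≃+* ℂ,
      ¬((∀ s : K i →+* ℂ, g • s = s) ↔ ∀ s : K j →+* ℂ, g • s = s))
    (hfor : ∀ a b, ¬p a → p b → IsEmpty (K a →+* K b))
    (hbb : ∀ a b, p a → p b → a ≠ b → ∀ (x : K a →+* ℂ) (y : K b →+* ℂ),
      ∃ σ : ℂ ≃+* ℂ, σ • x = (starRingAut : ℂ ≃+* ℂ) • x ∧ σ • y = y) :
    ∀ i j, i ≠ j → ∀ P : Submodule ℚ ((K i →+* ℂ) → ℚ), P ≤ antiSpan (ℂ ≃+* ℂ) (Φ i).1 →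
      (∀ g : ℂ ≃+* ℂ, ∀ f ∈ P, (fun x => f (g • x)) ∈ P) →
      ∀ T : ((K i →+* ℂ) → ℚ) →ₗ[ℚ] ((K j →+* ℂ) → ℚ),
        (∀ g : ℂ ≃+* ℂ, ∀ f ∈ P, T (fun x => f (g • x)) = fun y => T f (g • y)) →
        (∀ f ∈ P, T f ∈ antiSpan (ℂ ≃+* ℂ) (Φ j).1) → (∀ f ∈ P, T f = 0 → f = 0) → P = ⊥ := by
  classical
  have hCM : ∀ i, IsCMTypeWith (starRingAut : ℂ ≃+* ℂ) (Φ i).1 := fun i => isCMTypeWith_conj (Φ i)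
  have hc : ∀ j, ¬p j → Fintype.card (K j →+* ℂ) = 2 := fun j hj => by rw [Embeddings.card, h2 j hj]
  intro i j hij
  by_cases hi : p i <;> by_cases hj : p j
  · -- two big slots: (PC)
    exact (pairwise_of_pointwiseConj Φ (hbb i j hi hj hij)).1
  · -- `i` big, `j` quadratic and foreign to `K_i`
    exact (pairwise_of_isEmpty Φ (h2 j hj) (hfor j i hj hi)).2
  · -- `i` quadratic and foreign to `K_j`, `j` big
    exact (pairwise_of_isEmpty Φ (h2 i hi) (hfor i j hi hj)).1
  · -- two quadratic slots with different sign characters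
    have hquad : ∀ j, ¬p j → ∀ f ∈ antiSpan (ℂ ≃+* ℂ) (Φ j).1, ∀ g : ℂ ≃+* ℂ,
        (fun x => f (g • x)) = TwoSlot.slotSign (ℂ ≃+* ℂ) (fun i => K i →+* ℂ) j g • f := fun j hj f hf g =>
      PairwiseCC.comp_smul_eq_slotSign_smul (Φ := fun i => (Φ i).1) (hCM j) (hc j hj) hf g
    have hne : ∃ g : ℂ ≃+* ℂ,
        TwoSlot.slotSign (ℂ ≃+* ℂ) (fun i => K i →+* ℂ) i g ≠ TwoSlot.slotSign (ℂ ≃+* ℂ) (fun i => K i →+* ℂ) j g := by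
      obtain ⟨g, hg⟩ := hχ i j hi hj hij
      refine ⟨g, fun heq => hg ?_⟩
      rw [TwoSlot.forall_smul_eq_iff_slotSign_eq_one (G := ℂ ≃+* ℂ) (E := fun i => K i →+* ℂ)
          (Φ := fun i => (Φ i).1) (hCM i) (hc i hi) g,
        TwoSlot.forall_smul_eq_iff_slotSign_eq_one (G := ℂ ≃+* ℂ) (E := fun i => K i →+* ℂ)
          (Φ := fun i => (Φ i).1) (hCM j) (hc j hj) g, heq]
    exact (pairwise_of_eigenvector (G := ℂ ≃+* ℂ) (Φ := fun i => (Φ i).1) (i := i) (j := j)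
      (TwoSlot.slotSign (ℂ ≃+* ℂ) (fun i => K i →+* ℂ) i) (hquad i hi) fun f hf heig =>
        PairwiseCC.eq_zero_of_eigen_of_card_eq_two (Φ := fun i => (Φ i).1) (hCM j) (hc j hj) _ hne hf heig).1

variable [Fintype I] [DecidableEq I] [Nonempty I]

/-- **Nondegeneracy from the fourth menu**: the family is nondegenerate iff every non-quadratic member is.
[cite: MoonenZarhin1999LowDim, Thm. (0.2) (4)] [cite: Gordon1999HodgeAVSurvey, §3 Theorem and 7.5] -/
theorem isNondegenerateFamily_iff_of_menu₄ (p : I → Prop) (Φ : ∀ i, CMType (K i))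
    (h2 : ∀ j, ¬p j → Module.finrank ℚ (K j) = 2)
    (hχ : ∀ i j, ¬p i → ¬p j → i ≠ j → ∃ g : ℂ ≃+* ℂ,
      ¬((∀ s : K i →+* ℂ, g • s = s) ↔ ∀ s : K j →+* ℂ, g • s = s))
    (hfor : ∀ a b, ¬p a → p b → IsEmpty (K a →+* K b))
    (hbb : ∀ a b, p a → p b → a ≠ b → ∀ (x : K a →+* ℂ) (y : K b →+* ℂ),
      ∃ σ : ℂ ≃+* ℂ, σ • x = (starRingAut : ℂ ≃+* ℂ) • x ∧ σ • y = y) :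
    CMAlgebra.IsNondegenerateFamily Φ ↔ ∀ b, p b → IsNondegenerate (Φ b) := by
  rw [isNondegenerateFamily_iff_forall_of_pairwise Φ (pairwise_of_menu₄ p Φ h2 hχ hfor hbb)]
  refine ⟨fun H b _ => H b, fun H i => ?_⟩
  by_cases hi : p i
  · exact H i hi
  · exact isNondegenerate_of_finrank_eq_two (Φ i) (h2 i hi)

/-- **Rank additivity from the fourth menu**: `rank((Φ_i)_i) + |I| = Σ_i rank(Φ_i) + 1`
(`rank Hg(∏_j E_j × ∏_b A_b) = Σ rank Hg`), for ALL types. [cite: Gordon1999HodgeAVSurvey, §3 Theorem (1)] -/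
theorem cmFamilyRank_add_card_eq_of_menu₄ (p : I → Prop) (Φ : ∀ i, CMType (K i))
    (h2 : ∀ j, ¬p j → Module.finrank ℚ (K j) = 2)
    (hχ : ∀ i j, ¬p i → ¬p j → i ≠ j → ∃ g : ℂ ≃+* ℂ,
      ¬((∀ s : K i →+* ℂ, g • s = s) ↔ ∀ s : K j →+* ℂ, g • s = s))
    (hfor : ∀ a b, ¬p a → p b → IsEmpty (K a →+* K b))
    (hbb : ∀ a b, p a → p b → a ≠ b → ∀ (x : K a →+* ℂ) (y : K b →+* ℂ),
      ∃ σ : ℂ ≃+* ℂ, σ • x = (starRingAut : ℂ ≃+* ℂ) • x ∧ σ • y = y) :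
    CMAlgebra.cmFamilyRank Φ + Fintype.card I = (∑ i, cmTypeRank (Φ i)) + 1 :=
  cmFamilyRank_add_card_eq_of_pairwise Φ (pairwise_of_menu₄ p Φ h2 hχ hfor hbb)

/-- **The exact criterion under (PC) inside `B`: a shared imaginary quadratic field is the only obstruction.**  For a
family with imaginary quadratic slots off `B`, pairwise distinguished, and (PC) between the big fields: `(Φ_i)_i` is
nondegenerate iff every `Φ_b` (`b ∈ B`) is nondegenerate AND no quadratic field `K_a` embeds in a `K_b` (⟸: the
fourth menu; ⟹: members of nondegenerate families are nondegenerate, and a quadratic field shared by two slots makes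
every family degenerate). [cite: MoonenZarhin1999LowDim, Thm. (0.2) (a) and (4)] [cite: Gordon1999HodgeAVSurvey, 7.5–7.7] -/
theorem isNondegenerateFamily_iff_forall_isEmpty_of_pointwiseConj (p : I → Prop) (Φ : ∀ i, CMType (K i))
    (h2 : ∀ j, ¬p j → Module.finrank ℚ (K j) = 2)
    (hχ : ∀ i j, ¬p i → ¬p j → i ≠ j → ∃ g : ℂ ≃+* ℂ,
      ¬((∀ s : K i →+* ℂ, g • s = s) ↔ ∀ s : K j →+* ℂ, g • s = s))
    (hbb : ∀ a b, p a → p b → a ≠ b → ∀ (x : K a →+* ℂ) (y : K b →+* ℂ),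
      ∃ σ : ℂ ≃+* ℂ, σ • x = (starRingAut : ℂ ≃+* ℂ) • x ∧ σ • y = y) :
    CMAlgebra.IsNondegenerateFamily Φ ↔
      (∀ b, p b → IsNondegenerate (Φ b)) ∧ ∀ a b, ¬p a → p b → IsEmpty (K a →+* K b) := by
  refine ⟨fun H => ⟨fun b _ => H.isNondegenerate b, fun a b ha hb => ⟨fun j => ?_⟩⟩,
    fun H => (isNondegenerateFamily_iff_of_menu₄ p Φ h2 hχ H.2 hbb).2 H.1⟩
  have hab : a ≠ b := fun h => ha (h ▸ hb)
  exact not_isNondegenerateFamily_of_shared_imaginary_quadratic (k := K a) (h2 a ha) hab (RingHom.id (K a)) j Φ H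

end Fields

/-! ## §2 Geometry: curves with foreign fields times CM abelian varieties under (PC) -/

section Geometry

variable {I : Type} {K : I → Type} [∀ i, Field (K i)] [∀ i, NumberField (K i)] [∀ i, IsCMField (K i)] [Fintype I]
  [DecidableEq I] [Nonempty I] {Φ : ∀ i, CMType (K i)}
variable {A : I → AbelianVariety ℂ} {ι : ∀ i, 𝓞 (K i) →+* End (A i)}
  {θ : ∀ i, K i →+* Module.End ℂ (complexBetti (A i).X 1)}

/-- **The Hodge conjecture from the fourth menu**: every `⨁_{k<N} A_{π k}` for a family with a separating imaginary
quadratic sub-family off `B`, every quadratic field foreign to every `K_b`, (PC) between the big fields, and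
nondegenerate types on `B` — unconditionally. [cite: MoonenZarhin1999LowDim, Thm. (0.2) (4)]
[cite: Gordon1999HodgeAVSurvey, §3 Theorem and 10.10] -/
theorem hodgeConjectureFor_prod_of_menu₄ (p : I → Prop) (h2 : ∀ j, ¬p j → Module.finrank ℚ (K j) = 2)
    (hsep : CMAlgebra.IsSeparatingFamily (fun j : {j // ¬p j} => Φ j.1))
    (hfor : ∀ a b, ¬p a → p b → IsEmpty (K a →+* K b))
    (hbb : ∀ a b, p a → p b → a ≠ b → ∀ (x : K a →+* ℂ) (y : K b →+* ℂ),
      ∃ σ : ℂ ≃+* ℂ, σ • x = (starRingAut : ℂ ≃+* ℂ) • x ∧ σ • y = y)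
    (hΦ : ∀ b, p b → IsNondegenerate (Φ b)) (hA : ∀ i, IsCMTypeRealisation (Φ i) (A i) (ι i) (θ i)) {N : ℕ}
    (π : Fin N → I) : HodgeConjectureFor (⨁ fun j : Fin N => A (π j)).dim (⨁ fun j : Fin N => A (π j)).X :=
  ((isNondegenerateFamily_iff_of_menu₄ p Φ h2 (exists_not_iff_of_isSeparatingFamily p Φ h2 hsep) hfor hbb).2
    hΦ).hodgeConjectureFor_prod hA π

/-- **`Bᵐ ⊗ ℂ = Dᵐ ⊗ ℂ` from the fourth menu** (no exotic Hodge class on any `⨁_{k<N} A_{π k}`).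
[cite: MoonenZarhin1999LowDim, Thm. (0.2) (4)] [cite: Gordon1999HodgeAVSurvey, §3 Theorem (2) and 7.5] -/
theorem hodgeClassSpan_prod_eq_divisorClassesSpan_of_menu₄ (p : I → Prop)
    (h2 : ∀ j, ¬p j → Module.finrank ℚ (K j) = 2) (hsep : CMAlgebra.IsSeparatingFamily (fun j : {j // ¬p j} => Φ j.1))
    (hfor : ∀ a b, ¬p a → p b → IsEmpty (K a →+* K b))
    (hbb : ∀ a b, p a → p b → a ≠ b → ∀ (x : K a →+* ℂ) (y : K b →+* ℂ),
      ∃ σ : ℂ ≃+* ℂ, σ • x = (starRingAut : ℂ ≃+* ℂ) • x ∧ σ • y = y)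
    (hΦ : ∀ b, p b → IsNondegenerate (Φ b)) (hA : ∀ i, IsCMTypeRealisation (Φ i) (A i) (ι i) (θ i)) {N : ℕ}
    (π : Fin N → I) (m : ℕ) :
    hodgeClassSpan (⨁ fun j : Fin N => A (π j)).dim (⨁ fun j : Fin N => A (π j)).X m =
      divisorClassesSpan (⨁ fun j : Fin N => A (π j)).X (⨁ fun j : Fin N => A (π j)).dim m :=
  ((isNondegenerateFamily_iff_of_menu₄ p Φ h2 (exists_not_iff_of_isSeparatingFamily p Φ h2 hsep) hfor hbb).2
    hΦ).hodgeClassSpan_prod_eq_divisorClassesSpan hA π m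

/-- **`B• = D•` on ALL products iff the big types are nondegenerate and no curve field embeds in a `K_b`** — for a
SEPARATING family of realisations with imaginary quadratic slots off `B` and (PC) between the big fields: the divisor
regime ends exactly where an imaginary quadratic field is shared. [cite: MoonenZarhin1999LowDim, Thm. (0.2) (a) and (4)]
[cite: Gordon1999HodgeAVSurvey, 7.5] -/
theorem forall_prod_hodgeClassSpan_eq_iff_forall_isEmpty_of_pointwiseConj (p : I → Prop)
    (h2 : ∀ j, ¬p j → Module.finrank ℚ (K j) = 2) (hsep : CMAlgebra.IsSeparatingFamily Φ)
    (hbb : ∀ a b, p a → p b → a ≠ b → ∀ (x : K a →+* ℂ) (y : K b →+* ℂ),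
      ∃ σ : ℂ ≃+* ℂ, σ • x = (starRingAut : ℂ ≃+* ℂ) • x ∧ σ • y = y)
    (hA : ∀ i, IsCMTypeRealisation (Φ i) (A i) (ι i) (θ i)) :
    (∀ (N : ℕ) (π : Fin N → I) (m : ℕ),
      hodgeClassSpan (⨁ fun j : Fin N => A (π j)).dim (⨁ fun j : Fin N => A (π j)).X m =
        divisorClassesSpan (⨁ fun j : Fin N => A (π j)).X (⨁ fun j : Fin N => A (π j)).dim m) ↔
      (∀ b, p b → IsNondegenerate (Φ b)) ∧ ∀ a b, ¬p a → p b → IsEmpty (K a →+* K b) := by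
  rw [← CMAlgebra.isNondegenerateFamily_iff_forall_prod_hodgeClassSpan_eq hsep hA]
  exact isNondegenerateFamily_iff_forall_isEmpty_of_pointwiseConj p Φ h2
    (exists_not_iff_of_isSeparatingFamily p Φ h2 (isSeparatingFamily_subtype hsep _)) hbb

end Geometry

end Summit.HodgeConjecture.CorCM

end
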